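import Summits.CriticalPhenomena.PercolationContinuityZ3.Theorems.PercNearOneGluingNoHeavyQuantWindowMix
import Summits.CriticalPhenomena.PercolationContinuityZ3.Theorems.PercNearOneGluingNoHeavyQuantSliceLawSWHolds
import Summits.CriticalPhenomena.PercolationContinuityZ3.Theorems.PercNearOneGluingNoHeavyQuantLowToZeroMove
import HarnessLib

/-!
# QUANT lane R8, T-DEC, leg (III): TOOLS FOR THE DUAL ROUTE TO THE WINDOW FORM CW — the slice theorem's single-layer domination WITH ITS
# LAYER RULE exported (`sliceSingleLayer_rule`), target monotonicity of price systems, the single-layer weak-duality step for the mixture, and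
# the Lemma-P bookkeeping `P = Σ_r λ_r (zδ₀ + (1−z)·slice τ_r)` (part 1 of 2; part 2 `…QuantWindowMixZero`: CW ⟸ ONE law-level lemma)

builds on p205010 (kernel theorem, internal audit signed; external expert review pending)

Support file (`--supports stmt-CriticalPhenomena-4575`), QUANT lane lead seat prim-quant-lead (gen 31), rung R8 of
`run/shared/lean/prim/quant/LADDER.md`.  Theorems only, standard axioms, no sorries.  Continues this seat's `…QuantWindowMix` (p342481:
`WindowMixDEC` = CW, `windowMixPullback`, `windowMix_functional_eq`, `sum_windowMixPullback`), census-2 g55's `…QuantSliceSingleLayer{,Reduction,Laws}`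
and typer g24's `…QuantSliceLawSWHolds` (`sliceMidLemmaD_holds`, `sliceLawSW_holds`), typer g28's `usage_le_of_target_le`.

* **`LawDec.sliceSingleLayer_rule`** — `SliceSingleLayer` (PROVED, `sliceSingleLayer_holds`) restated with census-2 g55's RULE in the conclusion: a
  cheapest giant position `q₀`, the layer `J = max(j′−a, largest cheap window atom) ≤ M`, every window atom above `J` priced `≥ β q₀`, and the
  pullback a price system at `(T, J)`.  The proof is `sliceSingleLayer_of_midLemmas` verbatim (the rule was inside it).  The dual route to CW needs
  the rule, not only `∃ J` (LEAD-NOTES-G31 N118 (d)): at other window layers the zero pairs of the re-priced pullback fail.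
* **`LawDec.priceValid_mono_target`** — a price system at `(T, J)` (explicit inequalities) is one at `(S, J)` for every `S ≥ T`.
* **`LawDec.windowMix_prices_of_layer`** — the single-layer certificate step of `WindowMixSingleLayer → WindowMixDEC`, isolated: if
  `windowMixPullback t g z S m ζ j a α β` (`ζ ≥ 0`) is a price system at `(S, J)` and `ν` is DEC at `(y, S, J)`, then `(α, β)` satisfies the
  weak-duality inequality of the mixture `(1−g)ν + g·shiftBut ν a z` at `(t, j)`.
* **`LawDec.windowMix_eq_sum_extreme`** — for `ν = Σ_r λ_r (zδ₀ + (1−z)τ_r)` (`Σ λ = 1`): `(1−g)ν + g·shiftBut ν a z = Σ_r λ_r (zδ₀ + (1−z)·slice τ_r a g)`.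
HONEST STATUS: `WindowMixDEC`, `WindowMixSingleLayer`, `GateMove`, `GatedConvEmptyFree`, `SingleGateConvClosed`, `SDECConvClosed`, `TreeDEC`, `FarTreeRow`
OPEN; RATE class log\* / honest sentence unchanged.

[this work]; single-layer domination and its rule: prim-quant-census-2 g55 (SINGLE-LAYER-G55), prim-quant-stmt g24 (this lane).  The gluing rows served
[cite: KozmaNitzan2024, Conjecture 3 (p. 15)]; product measure [cite: Grimmett1999, §1.3 p. 10]; Farkas [cite: Schrijver1986, Cor 7.1f (p. 90)].
-/

noncomputable section

namespace Summit.CriticalPhenomena.PercolationContinuityZ3.Theorems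

namespace Quant

open Finset

namespace LawDec

/-! ### (1) The slice theorem's single-layer domination with its layer rule exported -/

/-- **`SliceSingleLayer` WITH THE RULE** (census-2 g55's architecture, proved by typer g24's `sliceLawSW_holds`): for a slice price system `(α, β)` at
`(T + ag, j′)` there are a cheapest giant position `q₀` (`j′+1 ≤ q₀ ≤ M+a`, `β q₀ ≤ β q` for every giant position) and a window layer `J ≤ M`
(`j′ − a ≤ J ≤ j′`; the largest cheap window atom, else `j′ − a`) such that every window atom ABOVE `J` is expensive (`β q₀ ≤ −Φ h` for
`J < h ≤ j′`, `h ≤ M`) and the pullback `Φ = slicePullback (T+ag) g j′ a α β` is a price system at `(T, J)`.  The proof is census-2 g55's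
`sliceSingleLayer_of_midLemmas` verbatim with the rule kept in the conclusion. [this work] -/
theorem sliceSingleLayer_rule (x g T : ℝ) (M a j' : ℕ) (α β : ℕ → ℝ)
    (hx0 : 0 < x) (hx1 : x < 1) (hxg : x ≤ g) (hg1 : g ≤ 1) (ha : 1 ≤ a) (hjM : j' < M + a)
    (hβ : ∀ h, 0 ≤ β h)
    (hαβ : ∀ l h, l ≤ j' → 2 * (l : ℝ) < T + (a : ℝ) * g → h ≤ M + a →
      (j' + 1 ≤ h ∨ T + (a : ℝ) * g < (l : ℝ) + h) → α l ≤ usage x (T + (a : ℝ) * g) j' l h * β h) :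
    ∃ J q₀ : ℕ, j' ≤ J + a ∧ J ≤ j' ∧ J ≤ M ∧ j' + 1 ≤ q₀ ∧ q₀ ≤ M + a ∧
      (∀ q, j' + 1 ≤ q → q ≤ M + a → β q₀ ≤ β q) ∧
      (∀ h, J + 1 ≤ h → h ≤ j' → h ≤ M → β q₀ ≤ - slicePullback (T + (a : ℝ) * g) g j' a α β h) ∧
      (∀ h, h ≤ M → ¬ (h ≤ J ∧ 2 * (h : ℝ) < T) → slicePullback (T + (a : ℝ) * g) g j' a α β h ≤ 0) ∧
      (∀ l h, l ≤ J → 2 * (l : ℝ) < T → h ≤ M → (J + 1 ≤ h ∨ T < (l : ℝ) + h) →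
        slicePullback (T + (a : ℝ) * g) g j' a α β l
          ≤ usage x T J l h * (- slicePullback (T + (a : ℝ) * g) g j' a α β h)) := by
  classical
  have hD : SliceMidLemmaD := sliceMidLemmaD_holds
  have hW : SliceMidLemmaW := sliceMidLemmaW_of_lawSW sliceLawSW_holds
  set Φ : ℕ → ℝ := slicePullback (T + (a : ℝ) * g) g j' a α β with hΦ
  -- a cheapest giant position
  have hne : (Finset.Icc (j' + 1) (M + a)).Nonempty := ⟨j' + 1, Finset.mem_Icc.2 ⟨le_rfl, by omega⟩⟩
  obtain ⟨q₀, hq₀mem, hq₀min⟩ := Finset.exists_min_image (Finset.Icc (j' + 1) (M + a)) β hne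
  rw [Finset.mem_Icc] at hq₀mem
  have hq₀ : ∀ q, j' + 1 ≤ q → q ≤ M + a → β q₀ ≤ β q := fun q h1 h2 => hq₀min q (Finset.mem_Icc.2 ⟨h1, h2⟩)
  -- the cheap window atoms
  set C : Finset ℕ := (Finset.Icc (j' + 1 - a) (min j' M)).filter (fun h => - Φ h < β q₀) with hC
  have hCmem : ∀ h, h ∈ C ↔ (j' < h + a ∧ h ≤ j' ∧ h ≤ M) ∧ - Φ h < β q₀ := by
    intro h
    rw [hC, Finset.mem_filter, Finset.mem_Icc]
    constructor
    · rintro ⟨⟨h1, h2⟩, h3⟩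
      exact ⟨⟨by omega, le_trans h2 (min_le_left _ _), le_trans h2 (min_le_right _ _)⟩, h3⟩
    · rintro ⟨⟨h1, h2, h3⟩, h4⟩
      exact ⟨⟨by omega, le_min h2 h3⟩, h4⟩
  -- the layer
  let J : ℕ := if hCne : C.Nonempty then C.max' hCne else j' - a
  have hJwin : j' ≤ J + a ∧ J ≤ j' ∧ J ≤ M := by
    by_cases hCne : C.Nonempty
    · have hJ : J = C.max' hCne := by simp only [J, dif_pos hCne]
      have hm := ((hCmem _).1 (Finset.max'_mem C hCne)).1
      rw [hJ]
      exact ⟨by omega, hm.2.1, hm.2.2⟩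
    · have hJ : J = j' - a := by simp only [J, dif_neg hCne]
      rw [hJ]
      omega
  -- window atoms above J are not cheap
  have hnotcheap : ∀ h, J + 1 ≤ h → h ≤ j' → h ≤ M → β q₀ ≤ - Φ h := by
    intro h h1 h2 h3
    by_contra hle
    have hlt : - Φ h < β q₀ := not_le.1 hle
    have hmem : h ∈ C := (hCmem h).2 ⟨⟨by omega, h2, h3⟩, hlt⟩
    have hCne : C.Nonempty := ⟨h, hmem⟩
    have hJ : J = C.max' hCne := by simp only [J, dif_pos hCne]
    have := Finset.le_max' C h hmem
    omega
  -- if a window atom lies at or below J then J is a cheap window atom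
  have hJcheap : ∀ h, h ≤ J → j' < h + a → 0 < h → (J ≤ j' ∧ J ≤ M ∧ j' < J + a) ∧ - Φ J < β q₀ := by
    intro h h1 h2 h0
    by_cases hCne : C.Nonempty
    · have hJ : J = C.max' hCne := by simp only [J, dif_pos hCne]
      have hm := (hCmem _).1 (Finset.max'_mem C hCne)
      rw [hJ]
      exact ⟨⟨hm.1.2.1, hm.1.2.2, hm.1.1⟩, hm.2⟩
    · have hJ : J = j' - a := by simp only [J, dif_neg hCne]
      exfalso
      omega
  refine ⟨J, q₀, hJwin.1, hJwin.2.1, hJwin.2.2, hq₀mem.1, hq₀mem.2, hq₀, hnotcheap, ?_, ?_⟩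
  · -- absorber conditions
    intro h hhM hnl
    by_cases hT : T ≤ 2 * (h : ℝ)
    · exact slicePullback_nonpos_of_absorber x g T M a j' α β hx0 hx1 hxg hg1 ha hβ hαβ h hhM (Or.inl hT)
    · have hJh : J < h := by
        by_contra hle
        exact hnl ⟨not_lt.1 hle, not_le.1 hT⟩
      exact slicePullback_nonpos_of_absorber x g T M a j' α β hx0 hx1 hxg hg1 ha hβ hαβ h hhM (Or.inr (by omega))
  · -- low conditions
    intro l h hlJ hlow hhM hcomp
    have hlh : l < h := by
      rcases hcomp with hc | hc
      · omega
      · have : (l : ℝ) < h := by linarith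
        exact_mod_cast this
    have habs : 0 ≤ - Φ h := by
      have hor : T ≤ 2 * (h : ℝ) ∨ j' < h + a := by
        rcases hcomp with hc | hc
        · right; omega
        · left; linarith
      linarith [slicePullback_nonpos_of_absorber x g T M a j' α β hx0 hx1 hxg hg1 ha hβ hαβ h hhM hor]
    have hupos : 0 < usage x T J l h := usage_pos_of_compat x T J l h hx0 hx1 hlow hlh hcomp
    by_cases hwl : j' < l + a
    · have h0 := slicePullback_windowLow x g T M a j' α β hx0 hx1 hxg hg1 ha hβ hαβ l (by omega) hwl
      have : 0 ≤ usage x T J l h * (- Φ h) := mul_nonneg hupos.le habs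
      linarith
    · have hla : l + a ≤ j' := not_lt.1 hwl
      rcases hcomp with hJh | hmid
      · by_cases hg' : j' + 1 ≤ h
        · exact slicePullback_giant_condition x g T M a j' α β hx0 hx1 hxg hg1 hβ hαβ l h J q₀ hla hlow hq₀mem.1 hq₀mem.2 hJh
            (slicePullback_trueGiant_expensive x g T M a j' α β hx0 hxg hg1 h q₀ hg' hhM hq₀)
        · exact slicePullback_giant_condition x g T M a j' α β hx0 hx1 hxg hg1 hβ hαβ l h J q₀ hla hlow hq₀mem.1 hq₀mem.2 hJh
            (hnotcheap h hJh (by omega) hhM)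
      · by_cases hJh : J + 1 ≤ h
        · by_cases hg' : j' + 1 ≤ h
          · exact slicePullback_giant_condition x g T M a j' α β hx0 hx1 hxg hg1 hβ hαβ l h J q₀ hla hlow hq₀mem.1 hq₀mem.2 hJh
              (slicePullback_trueGiant_expensive x g T M a j' α β hx0 hxg hg1 h q₀ hg' hhM hq₀)
          · exact slicePullback_giant_condition x g T M a j' α β hx0 hx1 hxg hg1 hβ hαβ l h J q₀ hla hlow hq₀mem.1 hq₀mem.2 hJh
              (hnotcheap h hJh (by omega) hhM)
        · have hhJ : h ≤ J := by omega
          have hT2 : T ≤ 2 * (h : ℝ) := by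
            have : (l : ℝ) < h := by exact_mod_cast hlh
            linarith
          by_cases hD' : h + a ≤ j'
          · exact hD x g T M a j' α β hx0 hx1 hxg hg1 ha hjM hβ hαβ l h J hla hlow hhM hD' hT2 hmid hhJ
          · have hwin : j' < h + a := not_le.1 hD'
            obtain ⟨⟨hJ1, hJ2, hJ3⟩, hJc⟩ := hJcheap h hhJ hwin (by omega)
            exact hW x g T M a j' α β hx0 hx1 hxg hg1 ha hjM hβ hαβ q₀ hq₀mem.1 hq₀mem.2 hq₀ J hJ1 hJ2 hJ3 hJc
              l h J hla hlow hhJ hwin hT2 hmid hhJ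

/-! ### (1b) Price systems are monotone in the target -/

/-- **a price system at `(T, J)` is a price system at `(S, J)` for every `S ≥ T`** (explicit-inequality form; `0 < y < 1`): an `S`-absorber is a
`T`-absorber; an `S`-low is either a `T`-low (then `usage_T ≤ usage_S`, typer g28's `usage_le_of_target_le`) or a `T`-absorber (then its price is
`≤ 0 ≤ usage·(−Φ h)`). [this work] -/
theorem priceValid_mono_target (y T S : ℝ) (J M : ℕ) (Φ : ℕ → ℝ) (hy0 : 0 < y) (hy1 : y < 1) (hTS : T ≤ S)
    (habs : ∀ h, h ≤ M → ¬ (h ≤ J ∧ 2 * (h : ℝ) < T) → Φ h ≤ 0)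
    (hpairs : ∀ l h, l ≤ J → 2 * (l : ℝ) < T → h ≤ M → (J + 1 ≤ h ∨ T < (l : ℝ) + h) → Φ l ≤ usage y T J l h * (- Φ h)) :
    (∀ h, h ≤ M → ¬ (h ≤ J ∧ 2 * (h : ℝ) < S) → Φ h ≤ 0) ∧
    (∀ l h, l ≤ J → 2 * (l : ℝ) < S → h ≤ M → (J + 1 ≤ h ∨ S < (l : ℝ) + h) → Φ l ≤ usage y S J l h * (- Φ h)) := by
  refine ⟨fun h hhM hnl => habs h hhM (fun hc => hnl ⟨hc.1, lt_of_lt_of_le hc.2 hTS⟩), ?_⟩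
  intro l h hlJ hlow hhM hcomp
  have hlh : l < h := by
    rcases hcomp with hc | hc
    · omega
    · have : (l : ℝ) < h := by linarith
      exact_mod_cast this
  have hhabs : Φ h ≤ 0 := by
    refine habs h hhM (fun hc => ?_)
    rcases hcomp with hc' | hc'
    · omega
    · linarith [hc.2]
  by_cases hlT : 2 * (l : ℝ) < T
  · have hcT : J + 1 ≤ h ∨ T < (l : ℝ) + h := by
      rcases hcomp with hc | hc
      · exact Or.inl hc
      · exact Or.inr (by linarith)
    have h1 := hpairs l h hlJ hlT hhM hcT
    have h2 := usage_le_of_target_le y T S J l h hy0 hy1 hTS hlT hlh hcomp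
    have h3 : usage y T J l h * (- Φ h) ≤ usage y S J l h * (- Φ h) := mul_le_mul_of_nonneg_right h2 (by linarith)
    linarith
  · have hl0 : Φ l ≤ 0 := habs l (by omega) (fun hc => hlT hc.2)
    have hu : 0 < usage y S J l h := usage_pos_of_compat y S J l h hy0 hy1 hlow hlh hcomp
    have : 0 ≤ usage y S J l h * (- Φ h) := mul_nonneg hu.le (by linarith)
    linarith

/-! ### (3) The single-layer weak-duality step -/

/-- **the single-layer certificate step**: for the CW data and a price system `(α, β)` of the mixture positions at any target `t` and layer `j`, if for some
window layer `J ≤ M`, tilt `m` and `ζ ≥ 0` the pullback `windowMixPullback t g z S m ζ j a α β` is a price system at `(S, J)` and `ν` is DEC at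
`(y, S, J)`, then `(α, β)` satisfies the weak-duality inequality for the mixture. [this work] -/
theorem windowMix_prices_of_layer (y z g S t m ζ : ℝ) (a j M J : ℕ) (ν α β : ℕ → ℝ)
    (hy0 : 0 < y) (hy1 : y < 1) (hzν : z ≤ ν 0) (hζ : 0 ≤ ζ)
    (hνM : ∀ h, M < h → ν h = 0) (hν1 : ∑ h ∈ Finset.range (M + 1), ν h = 1)
    (hS : S = ∑ h ∈ Finset.range (M + 1), (h : ℝ) * ν h)
    (hjM : j < M + a) (hJM : J ≤ M) (hdecJ : DECAtT y S J M ν)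
    (habs : ∀ h, h ≤ M → ¬ (h ≤ J ∧ 2 * (h : ℝ) < S) → windowMixPullback t g z S m ζ j a α β h ≤ 0)
    (hlows : ∀ l h, l ≤ J → 2 * (l : ℝ) < S → h ≤ M → (J + 1 ≤ h ∨ S < (l : ℝ) + h) →
      windowMixPullback t g z S m ζ j a α β l ≤ usage y S J l h * (- windowMixPullback t g z S m ζ j a α β h)) :
    ∑ l ∈ Finset.range (j + 1), (if 2 * (l : ℝ) < t then α l * ((1 - g) * ν l + g * shiftBut ν a z l) else 0)
      ≤ ∑ h ∈ Finset.range (M + a + 1),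
          (if h ≤ j ∧ 2 * (h : ℝ) < t then 0 else β h * ((1 - g) * ν h + g * shiftBut ν a z h)) := by
  set Φ : ℕ → ℝ := windowMixPullback t g z S m ζ j a α β with hΦ
  set β' : ℕ → ℝ := fun h => if h ≤ M ∧ ¬ (h ≤ J ∧ 2 * (h : ℝ) < S) then -Φ h else 0 with hβ'
  have hβ'eq : ∀ k, k ≤ M → ¬ (k ≤ J ∧ 2 * (k : ℝ) < S) → β' k = -Φ k := by
    intro k hk hnl
    have hc : k ≤ M ∧ ¬ (k ≤ J ∧ 2 * (k : ℝ) < S) := And.intro hk hnl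
    simp only [hβ', if_pos hc]
  have hβ'0 : ∀ h, 0 ≤ β' h := by
    intro h
    by_cases hc : h ≤ M ∧ ¬ (h ≤ J ∧ 2 * (h : ℝ) < S)
    · rw [hβ'eq h hc.1 hc.2]; linarith [habs h hc.1 hc.2]
    · simp only [hβ', if_neg hc]; exact le_rfl
  have hαβ' : ∀ l h, l ≤ J → 2 * (l : ℝ) < S → h ≤ M → (J + 1 ≤ h ∨ S < (l : ℝ) + h) → Φ l ≤ usage y S J l h * β' h := by
    intro l h hlJ hlow hhM hcomp
    have hnl : ¬ (h ≤ J ∧ 2 * (h : ℝ) < S) := by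
      rintro ⟨h1, h2⟩
      rcases hcomp with hc | hc
      · omega
      · linarith
    rw [hβ'eq h hhM hnl]
    exact hlows l h hlJ hlow hhM hcomp
  have wd := dual_le_of_decAtT y S J M ν hy0 hy1 hdecJ Φ β' hβ'0 hαβ'
  have wd_eq := dual_functional_eq S J M Φ β' ν hJM
  have hcoef : ∀ k ∈ Finset.range (M + 1), coefAt S J Φ β' k * ν k = Φ k * ν k := by
    intro k hk
    rw [coefAt_pullback_eq S J M Φ β' hβ'eq k (Nat.lt_succ_iff.1 (Finset.mem_range.1 hk))]
  rw [Finset.sum_congr rfl hcoef] at wd_eq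
  have hsumΦ := sum_windowMixPullback t g z S m ζ j a M α β ν hν1 hS
  have goal_eq := dual_functional_eq t j (M + a) α β (fun h => (1 - g) * ν h + g * shiftBut ν a z h) hjM.le
  rw [windowMix_functional_eq ν (coefAt t j α β) M a g z hνM] at goal_eq
  have hζν : 0 ≤ ζ * (ν 0 - z) := mul_nonneg hζ (by linarith)
  rw [hΦ] at wd_eq
  linarith [goal_eq, wd, wd_eq, hsumΦ, hζν]

/-! ### (4) Lemma P bookkeeping: the mixture as a mixture of extreme transforms -/

/-- **the mixture `P = (1−g)ν + g·shiftBut ν a z` of a law `ν = Σ_r λ_r (zδ₀ + (1−z)τ_r)` (`Σ λ = 1`) is `Σ_r λ_r (zδ₀ + (1−z)·slice τ_r a g)`.**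
[this work] -/
theorem windowMix_eq_sum_extreme {ρ : Type*} [Fintype ρ] (ν : ℕ → ℝ) (lam : ρ → ℝ) (τ : ρ → ℕ → ℝ) (a : ℕ) (g z : ℝ)
    (hlam : ∑ r, lam r = 1)
    (hν : ∀ q, ν q = z * (if q = 0 then (1 : ℝ) else 0) + (1 - z) * ∑ r, lam r * τ r q) (p : ℕ) :
    (1 - g) * ν p + g * shiftBut ν a z p
      = ∑ r, lam r * (z * (if p = 0 then (1 : ℝ) else 0) + (1 - z) * slice (τ r) a g p) := by
  rw [windowMix_eq_slice_add ν a g z p]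
  simp only [slice]
  rw [hν p]
  have hshift : (if a ≤ p then ν (p - a) else 0)
      = z * (if p = a then (1 : ℝ) else 0) + (1 - z) * ∑ r, lam r * (if a ≤ p then τ r (p - a) else 0) := by
    by_cases hap : a ≤ p
    · rw [if_pos hap, hν (p - a)]
      have e1 : (if p - a = 0 then (1 : ℝ) else 0) = (if p = a then (1 : ℝ) else 0) := by
        by_cases hpa : p = a
        · rw [if_pos (by omega), if_pos hpa]
        · rw [if_neg (by omega), if_neg hpa]
      rw [e1]
      congr 1
      congr 1
      exact Finset.sum_congr rfl fun r _ => by rw [if_pos hap]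
    · rw [if_neg hap, if_neg (by omega)]
      have : ∑ r, lam r * (if a ≤ p then τ r (p - a) else (0 : ℝ)) = 0 :=
        Finset.sum_eq_zero fun r _ => by rw [if_neg hap, mul_zero]
      rw [this]; ring
  rw [hshift]
  have e2 : ∑ r, lam r * (z * (if p = 0 then (1 : ℝ) else 0) + (1 - z) * ((1 - g) * τ r p + g * (if a ≤ p then τ r (p - a) else 0)))
      = z * (if p = 0 then (1 : ℝ) else 0) * ∑ r, lam r
        + (1 - z) * ((1 - g) * ∑ r, lam r * τ r p + g * ∑ r, lam r * (if a ≤ p then τ r (p - a) else 0)) := by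
    rw [Finset.mul_sum, Finset.mul_sum, Finset.mul_sum, ← Finset.sum_add_distrib, Finset.mul_sum, ← Finset.sum_add_distrib]
    refine Finset.sum_congr rfl fun r _ => ?_
    ring
  rw [e2, hlam]
  ring

end LawDec

end Quant

end Summit.CriticalPhenomena.PercolationContinuityZ3.Theorems
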